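import Literature.NumberTheory.IwasawaTheory.ClassicalMuVanishesGaloisPrimePowerRat
import Literature.NumberTheory.IwasawaTheory.ClassicalMuVanishesTwoPowerAscentRealFull
import HarnessLib

/-!
# The Ferrero–Washington ⊗ Iwasawa 1973 envelope: `μ_p = 0` for every number field whose Galois closure over `ℚ` has a
# commutator subgroup of `p`-power order (conditional on the named fact `ferreroWashington1979_classicalMuVanishes`; proved glue, no
# new definition, no new named fact)

`Proofs`-style file (theorems only, no `sorry`) in topic `NumberTheory/IwasawaTheory` (namespace `Literature.NumberTheory.IwasawaTheory`),
written by the prover seat `bsd-line-att-p3` g37 (cell `bsd-f1-sign2`, route `AlignedTransportAtTwo`, `--supports` stmt-BirchSwinnertonDyer-22298;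
closes nothing; nothing about elliptic curves or BSD is asserted).  Sequel of g36's `ClassicalMuVanishesGaloisPrimePowerRat` (Iwasawa 1973 §4:
`μ_p = 0` for every finite Galois `p`-POWER extension of `ℚ`, fact-free), which is the case «`Gal(K'/ℚ)` is itself a `p`-group» of the present file.

THE THEOREM.  Let `K'/ℚ` be finite Galois with group `G` and suppose the commutator subgroup `G' = [G, G]` has order `p^m`.  Then, GRANTED the
Ferrero–Washington theorem (tree named fact `ferreroWashington1979_classicalMuVanishes`: `μ_p = 0` for the cyclotomic `ℤ_p`-extension of every
abelian number field), `μ_p = 0` (growth form `ClassicalMuVanishes`) for every cyclotomic `ℤ_p`-extension of `K'`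
(`classicalMuVanishes_of_isGalois_rat_of_card_commutator_eq_prime_pow_of_ferreroWashington`), and of every number field embedding in `K'`
(`…_of_algebra_…`).  Proof (Iwasawa's §4 route, uniform in `p`): inside `ℚ̄` put `M = j(K')·ℚ(i)`, `i² = −1`; `M/ℚ` is Galois and its commutator
subgroup restricts INJECTIVELY into that of `Gal(j(K')/ℚ) ≅ G` (a commutator fixes `i`), so it has order `p^a`, `a ≤ m`; its fixed field `M₀ = M^{[G_M,G_M]}`
is the maximal abelian subfield of `M` — ABELIAN over `ℚ` (`Gal(M₀/ℚ) ≅ G_M^{ab}`) and TOTALLY COMPLEX (`i ∈ M₀`) — with `M/M₀` Galois of degree `p^a`;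
Ferrero–Washington gives `μ_p(M₀) = 0`, Iwasawa 1973 Thm. 3 («let `k` be totally imaginary if `l = 2`», tree
`classicalMu_of_isGalois_of_finrank_eq_prime_pow_of_isTotallyComplex`, fact-free) gives `μ_p(M) = 0`, and `μ = 0` descends along `K' → M`
(`classicalMuVanishes_of_isCyclotomic_of_finite_noGrowth`, Iwasawa §3 remark, fact-free).

WHY IT IS HERE (crux C2 `MainConjectureOfRankZeroBSDAtTwo`, honest scope).  The envelope «abelian base (Ferrero–Washington) + Galois `p`-power steps
(Iwasawa 1973) + finite descent» is, for the CYCLOTOMIC `μ`, the classical reach of print; in group-theoretic terms it is exactly «`[G, G]` is a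
`p`-group» for the Galois closure.  The carriers of C2's open input PFμ⁺ — the non-Galois cubic `ℚ(β)`, the `S₃`-sextic `ℚ(W[2])`, the degree-`12`
field `ℚ(W[2], i)` — all have `[G, G] = C₃`, NOT a `2`-group: they sit exactly one step outside this envelope at `p = 2` (while at `p = 3` the same
fields are inside it: `μ₃ = 0` for every `S₃`-cubic GRANTED Ferrero–Washington, `#[S₃, S₃] = 3`).  Nothing here moves C2; it records the boundary as a
theorem.  Examples inside the envelope: every Galois extension of `ℚ` with dihedral group of order `2^{m+1}` or `2p^m` (`p`), generalised quaternion,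
`A₄`-quartic closures at `p = 2` (`[A₄, A₄] = V₄`), `S₃`-fields at `p = 3`, every abelian-by-`p`-group tower.

* §1 group/Galois glue [folklore], PRIVATE: a commutator fixes every square root of `−1`; the fixed field of the commutator subgroup is abelian
  Galois; the order of a subgroup mapped injectively into a subgroup of order `p^m` is `p^a`; a field with `√−1` is totally complex.
* §2 ★★★ `classicalMuVanishes_of_isGalois_rat_of_card_commutator_eq_prime_pow_of_ferreroWashington`.
* §3 ★★ `classicalMuVanishes_of_algebra_isGalois_rat_of_card_commutator_eq_prime_pow_of_ferreroWashington` (every subfield / embedded field).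
* §4 `…_of_isPGroup_commutator_…` (`IsPGroup` phrasing) and the abelian sanity case `classicalMuVanishes_of_algebra_isAbelianGalois_rat_of_ferreroWashington`.
* §5 intrinsic forms over an abelian base `M₀` (no Galois closure over `ℚ`): `M₀` totally complex — every `p`; `p` odd — any `M₀`; `p = 2` with `M`
  totally real; and the subfield form of the first.

References: [Iwasawa1973MuInvariants] K. Iwasawa, *On the μ-invariants of ℤ_l-extensions* (1973), Thm. 3, §3 (remark after Thm. 2), §4;
[FerreroWashington1979] B. Ferrero, L. Washington, Ann. of Math. 109 (1979) 377–395 (main theorem); [Washington1997] §7.5, §13.3 Prop. 13.23, Prop. 4.11;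
[Lang1990] Ch. 10 §3 Thm. 3.4, Ch. 13 §4.
-/

set_option autoImplicit false

noncomputable section

open scoped NumberField Classical IntermediateField
open NumberField Field IntermediateField IsDedekindDomain Module Polynomial

namespace Literature.NumberTheory.IwasawaTheory

open Literature.NumberTheory.EllipticCurves Literature.NumberTheory.EllipticCurves.ZpExtension
  Literature.NumberTheory.GaloisRepresentations Literature.NumberTheory.NumberFields

/-! ## §1 Group-theoretic and Galois-theoretic glue -/

section Glue

variable {F L : Type*} [Field F] [Field L] [Algebra F L]

/-- An `F`-automorphism maps a square root `x` of `−1` to `± x`. [folklore] -/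
private theorem algEquiv_apply_eq_or_eq_neg_of_sq_eq_neg_one (σ : L ≃ₐ[F] L) {x : L} (hx : x ^ 2 = -1) :
    σ x = x ∨ σ x = -x := by
  have h1 : (σ x) ^ 2 = x ^ 2 := by rw [← map_pow, hx, map_neg, map_one]
  have h2 : (σ x - x) * (σ x + x) = 0 := by ring_nf; rw [h1]; ring
  rcases mul_eq_zero.mp h2 with h | h
  · exact Or.inl (sub_eq_zero.mp h)
  · exact Or.inr (eq_neg_of_add_eq_zero_left h)

/-- **A commutator fixes every square root of `−1`**: for `σ ∈ [Gal(L/F), Gal(L/F)]` and `x² = −1`, `σ x = x` (every automorphism acts on `x` by a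
sign, and signs commute). [folklore] -/
private theorem algEquiv_apply_eq_self_of_mem_commutator_of_sq_eq_neg_one {σ : L ≃ₐ[F] L} (hσ : σ ∈ commutator (L ≃ₐ[F] L))
    {x : L} (hx : x ^ 2 = -1) : σ x = x := by
  -- the stabiliser of `x` contains every commutator `⁅g₁, g₂⁆`
  suffices h : commutator (L ≃ₐ[F] L) ≤ MulAction.stabilizer (L ≃ₐ[F] L) x from h hσ
  rw [commutator_def, Subgroup.commutator_le]
  intro g₁ _ g₂ _
  rw [MulAction.mem_stabilizer_iff, commutatorElement_def]
  change g₁ (g₂ (g₁⁻¹ (g₂⁻¹ x))) = x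
  -- `g⁻¹ x = ± x` with the same sign as `g x`
  have hinv : ∀ g : L ≃ₐ[F] L, (g x = x → g⁻¹ x = x) ∧ (g x = -x → g⁻¹ x = -x) := by
    intro g
    constructor
    · intro h
      have := congrArg (fun y => g⁻¹ y) h
      simp only [← AlgEquiv.mul_apply, inv_mul_cancel, AlgEquiv.one_apply] at this
      exact this.symm
    · intro h
      have := congrArg (fun y => g⁻¹ y) h
      simp only [← AlgEquiv.mul_apply, inv_mul_cancel, AlgEquiv.one_apply, map_neg] at this
      exact (neg_eq_iff_eq_neg.mpr this).symm
  rcases algEquiv_apply_eq_or_eq_neg_of_sq_eq_neg_one g₁ hx with h₁ | h₁ <;>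
    rcases algEquiv_apply_eq_or_eq_neg_of_sq_eq_neg_one g₂ hx with h₂ | h₂
  · rw [(hinv g₂).1 h₂, (hinv g₁).1 h₁, h₂, h₁]
  · rw [(hinv g₂).2 h₂, map_neg, (hinv g₁).1 h₁, map_neg, h₂, neg_neg, h₁]
  · rw [(hinv g₂).1 h₂, (hinv g₁).2 h₁, map_neg, h₂, map_neg, h₁, neg_neg]
  · rw [(hinv g₂).2 h₂, map_neg, (hinv g₁).2 h₁, neg_neg, h₂, map_neg, h₁, neg_neg]

/-- **The fixed field of the commutator subgroup has commutative Galois group** (`Gal(L^{[G,G]}/F) ≅ G/[G,G] = G^{ab}`). [folklore] -/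
private theorem isMulCommutative_aut_fixedField_commutator [FiniteDimensional F L] [IsGalois F L] :
    IsMulCommutative (↥(fixedField (commutator (L ≃ₐ[F] L))) ≃ₐ[F] ↥(fixedField (commutator (L ≃ₐ[F] L)))) := by
  refine ⟨⟨fun x y => ?_⟩⟩
  let e := IsGalois.normalAutEquivQuotient (commutator (L ≃ₐ[F] L))
  obtain ⟨a, rfl⟩ := e.surjective x
  obtain ⟨b, rfl⟩ := e.surjective y
  rw [← map_mul, ← map_mul]
  exact congrArg e (mul_comm (G := Abelianization (L ≃ₐ[F] L)) a b)

/-- **The fixed field of the commutator subgroup is an ABELIAN Galois extension of the base** (the maximal abelian subextension). [folklore] -/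
private theorem isAbelianGalois_fixedField_commutator [FiniteDimensional F L] [IsGalois F L] :
    IsAbelianGalois F ↥(fixedField (commutator (L ≃ₐ[F] L))) :=
  haveI := isMulCommutative_aut_fixedField_commutator (F := F) (L := L)
  {}

/-- The order of a subgroup mapped by a group homomorphism INTO a subgroup of order `p^m`, injectively on the subgroup, is `p^a` with `a ≤ m`. [folklore] -/
private theorem exists_card_eq_prime_pow_of_injOn {G G' : Type*} [Group G] [Group G'] {p : ℕ} (hp : p.Prime) (f : G →* G') (H : Subgroup G)
    (H' : Subgroup G') (hHH' : ∀ x ∈ H, f x ∈ H') (hinj : ∀ x ∈ H, f x = 1 → x = 1) {m : ℕ} (hH' : Nat.card H' = p ^ m) :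
    ∃ a ≤ m, Nat.card H = p ^ a := by
  let g : H →* H' := (f.comp H.subtype).codRestrict H' fun x => hHH' x.1 x.2
  have hg : Function.Injective g := by
    rw [← MonoidHom.ker_eq_bot_iff, Subgroup.eq_bot_iff_forall]
    intro x hx
    rw [MonoidHom.mem_ker] at hx
    have hx' : f x.1 = 1 := by
      have := congrArg Subtype.val hx
      simpa [g] using this
    exact Subtype.ext (hinj x.1 x.2 hx')
  have hdvd : Nat.card H ∣ p ^ m := hH' ▸ Subgroup.card_dvd_of_injective g hg
  exact (Nat.dvd_prime_pow hp).mp hdvd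

/-- A number field containing a square root of `−1` is totally complex. [folklore] -/
private theorem isTotallyComplex_of_sq_eq_neg_one' {K : Type*} [Field K] [NumberField K] {x : K} (hx : x ^ 2 = -1) : IsTotallyComplex K := by
  refine ⟨fun w => ?_⟩
  rw [← InfinitePlace.not_isReal_iff_isComplex]
  intro hw
  have h : ((InfinitePlace.embedding_of_isReal hw x : ℝ) : ℂ) ^ 2 = -1 := by
    rw [InfinitePlace.embedding_of_isReal_apply, ← map_pow, hx, map_neg, map_one]
  have h' : (InfinitePlace.embedding_of_isReal hw x : ℝ) ^ 2 = -1 := by exact_mod_cast h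
  nlinarith [sq_nonneg (InfinitePlace.embedding_of_isReal hw x)]

end Glue

/-! ## §2 The envelope theorem -/

set_option maxHeartbeats 800000 in
/-- ★★★ **Ferrero–Washington ⊗ Iwasawa 1973: `μ_p = 0` for every finite Galois `K'/ℚ` whose COMMUTATOR SUBGROUP `[Gal(K'/ℚ), Gal(K'/ℚ)]` has
`p`-power order, and every cyclotomic `ℤ_p`-extension of `K'`** — GRANTED the Ferrero–Washington theorem (tree named fact
`ferreroWashington1979_classicalMuVanishes`; everything else is proved): `μ_p = 0` on the maximal abelian subfield `M₀ ∋ i` of `M = K'(i)` (Ferrero–Washington),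
`M/M₀` Galois of `p`-power order over a totally complex base (Iwasawa 1973 Thm. 3, fact-free in the tree), descent `K' → M` (Iwasawa §3).  Equivalently:
`K'` is a Galois `p`-power extension of an abelian number field.  The case «`Gal(K'/ℚ)` a `p`-group» is fact-free
(`classicalMuVanishes_of_isGalois_rat_of_finrank_eq_prime_pow`).  NOT covered (commutator `C₃`): `S₃`-cubics and sextics at `p = 2`.
[cite: FerreroWashington1979, main theorem] [cite: Iwasawa1973MuInvariants, Thm. 3, §3 (remark after Thm. 2), §4] [cite: Washington1997, §13.3 Prop. 13.23] -/
theorem classicalMuVanishes_of_isGalois_rat_of_card_commutator_eq_prime_pow_of_ferreroWashington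
    (hFW : ferreroWashington1979_classicalMuVanishes) (p : ℕ) [Fact p.Prime] (K' : Type) [Field K'] [NumberField K'] [IsGalois ℚ K']
    (m : ℕ) (hcomm : Nat.card (commutator (K' ≃ₐ[ℚ] K')) = p ^ m) (κ' : ZpExtension K' p) (hκ' : κ'.IsCyclotomic) :
    ClassicalMuVanishes κ' := by
  -- the copy `E = j(K') ⊆ ℚ̄`, a root `i` of `X² + 1`, `ℚ(i)` and the compositum `M = E ⊔ ℚ(i)`
  set e : K' →ₐ[ℚ] AlgebraicClosure ℚ := absEmbedding ℚ K' with he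
  set E : IntermediateField ℚ (AlgebraicClosure ℚ) := e.fieldRange with hE
  obtain ⟨i, hi⟩ : ∃ i : AlgebraicClosure ℚ, i ^ 2 = -1 := IsAlgClosed.exists_pow_nat_eq (-1) two_pos
  set Qi : IntermediateField ℚ (AlgebraicClosure ℚ) := IntermediateField.adjoin ℚ ({i} : Set (AlgebraicClosure ℚ)) with hQi
  set M : IntermediateField ℚ (AlgebraicClosure ℚ) := E ⊔ Qi with hM
  have hint : IsIntegral ℚ i := by
    refine ⟨X ^ 2 + 1, monic_X_pow_add_C _ two_ne_zero, ?_⟩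
    simp [hi]
  haveI : FiniteDimensional ℚ ↥E := (AlgEquiv.ofInjectiveField e).toLinearEquiv.finiteDimensional
  haveI : FiniteDimensional ℚ ↥Qi := IntermediateField.adjoin.finiteDimensional hint
  haveI : FiniteDimensional ℚ ↥M := IntermediateField.finiteDimensional_sup E Qi
  haveI : NumberField ↥E := NumberField.of_module_finite ℚ _
  haveI : NumberField ↥Qi := NumberField.of_module_finite ℚ _
  haveI : NumberField ↥M := NumberField.of_module_finite ℚ _
  -- Galois properties
  haveI hEgal : IsGalois ℚ ↥E := IsGalois.of_algEquiv (AlgEquiv.ofInjectiveField e)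
  have hiQ : i ∉ Set.range (algebraMap ℚ (AlgebraicClosure ℚ)) := by
    rintro ⟨q, hq⟩
    have h1 : (algebraMap ℚ (AlgebraicClosure ℚ)) (q ^ 2) = algebraMap ℚ (AlgebraicClosure ℚ) (-1) := by
      rw [map_pow, hq, hi, map_neg, map_one]
    have h2' : q ^ 2 = -1 := (algebraMap ℚ (AlgebraicClosure ℚ)).injective h1
    nlinarith [sq_nonneg q]
  have hQi2 : Module.finrank ℚ ↥Qi = 2 :=
    finrank_adjoin_simple_eq_two_of_sq_eq (a := (-1 : ℚ)) (by rw [hi, map_neg, map_one]) hiQ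
  haveI : Algebra.IsQuadraticExtension ℚ ↥Qi := ⟨hQi2⟩
  haveI hQigal : IsGalois ℚ ↥Qi := inferInstance
  haveI hMgal : IsGalois ℚ ↥M :=
    @FiniteGaloisIntermediateField.instIsGaloisSubtypeMemIntermediateFieldMax ℚ (AlgebraicClosure ℚ) _ _ _ E Qi hEgal hQigal
  have hQiM : Qi ≤ M := le_sup_right
  have hEM : E ≤ M := le_sup_left
  have hiM : i ∈ M := hQiM (IntermediateField.mem_adjoin_simple_self ℚ i)
  -- the tower `E ⊆ M` as types
  letI : Algebra ↥E ↥M := (IntermediateField.inclusion hEM).toRingHom.toAlgebra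
  haveI : IsScalarTower ℚ ↥E ↥M := IsScalarTower.of_algebraMap_eq fun _ ↦ rfl
  haveI : Module.Finite ↥E ↥M := Module.Finite.of_restrictScalars_finite ℚ ↥E ↥M
  -- the element `i ∈ M` and the commutator subgroup of `Gal(M/ℚ)`
  set iM : ↥M := ⟨i, hiM⟩ with hiMdef
  have hiM2 : iM ^ 2 = -1 := Subtype.ext (by rw [hiMdef]; simpa using hi)
  set GM' : Subgroup (↥M ≃ₐ[ℚ] ↥M) := commutator (↥M ≃ₐ[ℚ] ↥M) with hGM'
  -- (a) restriction to `E` is injective on the commutator subgroup and lands in the commutator subgroup of `Gal(E/ℚ) ≅ Gal(K'/ℚ)`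
  let ρ : (↥M ≃ₐ[ℚ] ↥M) →* (↥E ≃ₐ[ℚ] ↥E) := AlgEquiv.restrictNormalHom ↥E
  let θ : (↥E ≃ₐ[ℚ] ↥E) ≃* (K' ≃ₐ[ℚ] K') := (AlgEquiv.ofInjectiveField e).symm.autCongr
  let f : (↥M ≃ₐ[ℚ] ↥M) →* (K' ≃ₐ[ℚ] K') := θ.toMonoidHom.comp ρ
  have hf_mem : ∀ σ ∈ GM', f σ ∈ commutator (K' ≃ₐ[ℚ] K') := by
    intro σ hσ
    have h1 : GM'.map f ≤ commutator (K' ≃ₐ[ℚ] K') := by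
      rw [hGM', commutator_def, commutator_def, Subgroup.map_commutator]
      exact Subgroup.commutator_mono le_top le_top
    exact h1 (Subgroup.mem_map_of_mem f hσ)
  have hf_inj : ∀ σ ∈ GM', f σ = 1 → σ = 1 := by
    intro σ hσ hfσ
    have hρ : ρ σ = 1 := by
      have : θ (ρ σ) = θ 1 := by rw [map_one]; exact hfσ
      exact θ.injective this
    -- `σ` fixes `E` pointwise
    have hfixE : ∀ (x : AlgebraicClosure ℚ) (hx : x ∈ E), σ ⟨x, hEM hx⟩ = ⟨x, hEM hx⟩ := by
      intro x hx
      have h1 := AlgEquiv.restrictNormal_commutes σ ↥E ⟨x, hx⟩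
      have h2 : σ.restrictNormal ↥E = 1 := hρ
      rw [h2, AlgEquiv.one_apply] at h1
      exact h1.symm
    -- `σ` fixes `i`
    have hfixi : σ iM = iM := algEquiv_apply_eq_self_of_mem_commutator_of_sq_eq_neg_one hσ hiM2
    -- hence `σ` fixes `M = ℚ(E ∪ {i})` pointwise
    have hMadj : M = IntermediateField.adjoin ℚ ((E : Set (AlgebraicClosure ℚ)) ∪ {i}) := by
      rw [IntermediateField.adjoin_union, IntermediateField.adjoin_self]
    have key : (σ : ↥M →ₐ[ℚ] ↥M) = AlgHom.id ℚ ↥M := by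
      refine IntermediateField.algHom_ext_of_eq_adjoin ℚ hMadj fun x hx => ?_
      rcases hx with hx | hx
      · change σ ⟨x, _⟩ = ⟨x, _⟩
        exact hfixE x hx
      · rw [Set.mem_singleton_iff] at hx
        subst hx
        change σ ⟨x, hiM⟩ = ⟨x, hiM⟩
        exact hfixi
    ext x
    simpa using congrArg (fun φ => φ x) key
  obtain ⟨a, -, ha⟩ : ∃ a ≤ m, Nat.card GM' = p ^ a :=
    exists_card_eq_prime_pow_of_injOn (Fact.out : p.Prime) f GM' (commutator (K' ≃ₐ[ℚ] K')) hf_mem hf_inj hcomm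
  -- (b) the maximal abelian subfield `M₀ = M^{GM'}`: abelian Galois over `ℚ`, totally complex, `[M : M₀] = p^a`
  set M₀ : IntermediateField ℚ ↥M := fixedField GM' with hM₀
  haveI : NumberField ↥M₀ := NumberField.of_module_finite ℚ ↥M₀
  haveI : IsAbelianGalois ℚ ↥M₀ := isAbelianGalois_fixedField_commutator (F := ℚ) (L := ↥M)
  have hiM₀ : iM ∈ M₀ := by
    rw [hM₀, IntermediateField.mem_fixedField_iff]
    intro σ hσ
    exact algEquiv_apply_eq_self_of_mem_commutator_of_sq_eq_neg_one hσ hiM2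
  haveI : IsTotallyComplex ↥M₀ := by
    refine isTotallyComplex_of_sq_eq_neg_one' (x := (⟨iM, hiM₀⟩ : ↥M₀)) ?_
    exact Subtype.ext (by simpa using hiM2)
  haveI : IsGalois ↥M₀ ↥M := IsGalois.tower_top_of_isGalois ℚ ↥M₀ ↥M
  have hdegM : Module.finrank ↥M₀ ↥M = p ^ a := by rw [hM₀, IntermediateField.finrank_fixedField_eq_card, ha]
  -- (c) Ferrero–Washington on `M₀`, Iwasawa's ascent to `M`, descent to `K'`
  have hμM₀ : ∀ κ₀ : ZpExtension ↥M₀ p, κ₀.IsCyclotomic → ClassicalMuVanishes κ₀ :=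
    fun κ₀ hκ₀ ↦ hFW ↥M₀ p κ₀ hκ₀
  have hμM : ∀ κM : ZpExtension ↥M p, κM.IsCyclotomic → ClassicalMuVanishes κM :=
    classicalMu_of_isGalois_of_finrank_eq_prime_pow_of_isTotallyComplex p a ↥M₀ ↥M hdegM hμM₀
  let g : K' →+* ↥M :=
    { toFun := fun x ↦ ⟨e x, hEM (e.mem_fieldRange.mpr ⟨x, rfl⟩)⟩
      map_one' := Subtype.ext (by simp)
      map_mul' := fun x y ↦ Subtype.ext (by simp)
      map_zero' := Subtype.ext (by simp)
      map_add' := fun x y ↦ Subtype.ext (by simp) }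
  letI : Algebra K' ↥M := g.toAlgebra
  exact classicalMuVanishes_of_isCyclotomic_of_finite_noGrowth κ' hκ' ↥M hμM

/-! ## §3 Subfields -/

/-- ★★ **`μ_p = 0` for every number field that EMBEDS into a finite Galois `K'/ℚ` whose commutator subgroup has `p`-power order** (equivalently:
whose Galois closure over `ℚ` has this property; e.g. every subfield of a dihedral field of order `2p^m`, every `S₃`-cubic at `p = 3`, every
`A₄`-quartic at `p = 2`), and every cyclotomic `ℤ_p`-extension of it — GRANTED Ferrero–Washington: §2 on `K'` and the fact-free finite descent.
[cite: FerreroWashington1979, main theorem] [cite: Iwasawa1973MuInvariants, §3 (remark after Thm. 2) and §4] [cite: Washington1997, Prop. 4.11, §13.3 Prop. 13.23] -/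
theorem classicalMuVanishes_of_algebra_isGalois_rat_of_card_commutator_eq_prime_pow_of_ferreroWashington
    (hFW : ferreroWashington1979_classicalMuVanishes) (p : ℕ) [Fact p.Prime] (K K' : Type) [Field K] [NumberField K] [Field K']
    [NumberField K'] [Algebra K K'] [IsGalois ℚ K'] (m : ℕ) (hcomm : Nat.card (commutator (K' ≃ₐ[ℚ] K')) = p ^ m)
    (κ : ZpExtension K p) (hκ : κ.IsCyclotomic) : ClassicalMuVanishes κ :=
  classicalMuVanishes_of_isCyclotomic_of_finite_noGrowth κ hκ K'
    (fun κ' hκ' ↦ classicalMuVanishes_of_isGalois_rat_of_card_commutator_eq_prime_pow_of_ferreroWashington hFW p K' m hcomm κ' hκ')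

/-! ## §4 `p`-group phrasing -/

/-- ★★ The same envelope with the hypothesis phrased as «the commutator subgroup `[Gal(K'/ℚ), Gal(K'/ℚ)]` is a `p`-group» (`IsPGroup`), for `K'`
itself and for every number field `K` embedding in `K'` — GRANTED Ferrero–Washington.  For `Gal(K'/ℚ)` ABELIAN the commutator subgroup is trivial
and this is Ferrero–Washington itself (with the finite descent); for `Gal(K'/ℚ)` a `p`-group it is Iwasawa 1973 §4 (fact-free in the tree).
[cite: FerreroWashington1979, main theorem] [cite: Iwasawa1973MuInvariants, Thm. 3, §3, §4] -/
theorem classicalMuVanishes_of_algebra_isGalois_rat_of_isPGroup_commutator_of_ferreroWashington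
    (hFW : ferreroWashington1979_classicalMuVanishes) (p : ℕ) [Fact p.Prime] (K K' : Type) [Field K] [NumberField K] [Field K']
    [NumberField K'] [Algebra K K'] [IsGalois ℚ K'] (hG : IsPGroup p ↥(commutator (K' ≃ₐ[ℚ] K')))
    (κ : ZpExtension K p) (hκ : κ.IsCyclotomic) : ClassicalMuVanishes κ := by
  obtain ⟨m, hm⟩ := hG.exists_card_eq
  exact classicalMuVanishes_of_algebra_isGalois_rat_of_card_commutator_eq_prime_pow_of_ferreroWashington hFW p K K' m hm κ hκ

/-- ★ Sanity/compatibility: for an ABELIAN `K'/ℚ` the commutator subgroup is trivial (`= p^0` elements), so §3 applies to every number field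
embedding in an abelian number field — Ferrero–Washington plus the finite descent (Iwasawa §3), every prime `p`. [cite: FerreroWashington1979, main theorem]
[cite: Iwasawa1973MuInvariants, §3 (remark after Thm. 2)] -/
theorem classicalMuVanishes_of_algebra_isAbelianGalois_rat_of_ferreroWashington
    (hFW : ferreroWashington1979_classicalMuVanishes) (p : ℕ) [Fact p.Prime] (K K' : Type) [Field K] [NumberField K] [Field K']
    [NumberField K'] [Algebra K K'] [IsAbelianGalois ℚ K'] (κ : ZpExtension K p) (hκ : κ.IsCyclotomic) : ClassicalMuVanishes κ := by
  refine classicalMuVanishes_of_algebra_isGalois_rat_of_card_commutator_eq_prime_pow_of_ferreroWashington hFW p K K' 0 ?_ κ hκ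
  have h : commutator (K' ≃ₐ[ℚ] K') = ⊥ := by
    rw [commutator_eq_bot_iff_center_eq_top, Subgroup.center_eq_top]
  rw [h, pow_zero, Subgroup.card_bot]

/-! ## §5 Intrinsic forms over an abelian base (no Galois closure over `ℚ` needed) -/

/-- ★★ **Over a TOTALLY COMPLEX abelian base, every prime**: `M₀/ℚ` abelian and totally complex (e.g. `ℚ(ζ_n)`, `n ≥ 3`, or any imaginary abelian
field), `M/M₀` Galois of degree `p^m`: GRANTED Ferrero–Washington, `μ_p = 0` for every cyclotomic `ℤ_p`-extension of `M` — Ferrero–Washington on `M₀`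
and Iwasawa 1973 Thm. 3 («let `k` be totally imaginary if `l = 2`», fact-free in the tree); no Galois hypothesis on `M/ℚ`.
[cite: FerreroWashington1979, main theorem] [cite: Iwasawa1973MuInvariants, Thm. 3] -/
theorem classicalMu_of_isGalois_prime_pow_over_abelian_of_isTotallyComplex_of_ferreroWashington
    (hFW : ferreroWashington1979_classicalMuVanishes) (p : ℕ) [Fact p.Prime] (m : ℕ) (M₀ M : Type) [Field M₀] [NumberField M₀]
    [IsAbelianGalois ℚ M₀] [IsTotallyComplex M₀] [Field M] [NumberField M] [Algebra M₀ M] [IsGalois M₀ M]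
    (hdeg : Module.finrank M₀ M = p ^ m) : ∀ κ : ZpExtension M p, κ.IsCyclotomic → ClassicalMuVanishes κ :=
  classicalMu_of_isGalois_of_finrank_eq_prime_pow_of_isTotallyComplex p m M₀ M hdeg (fun κ₀ hκ₀ ↦ hFW M₀ p κ₀ hκ₀)

/-- ★★ **Over ANY abelian base, `p` odd**: `M₀/ℚ` abelian, `M/M₀` Galois of degree `p^m`, `p ≠ 2`: GRANTED Ferrero–Washington, `μ_p = 0` for every
cyclotomic `ℤ_p`-extension of `M` (Iwasawa 1973 Thm. 3 for odd `l`: no archimedean hypothesis).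
[cite: FerreroWashington1979, main theorem] [cite: Iwasawa1973MuInvariants, Thm. 3] -/
theorem classicalMu_of_isGalois_odd_prime_pow_over_abelian_of_ferreroWashington
    (hFW : ferreroWashington1979_classicalMuVanishes) (p : ℕ) [Fact p.Prime] (hodd : p ≠ 2) (m : ℕ) (M₀ M : Type) [Field M₀]
    [NumberField M₀] [IsAbelianGalois ℚ M₀] [Field M] [NumberField M] [Algebra M₀ M] [IsGalois M₀ M]
    (hdeg : Module.finrank M₀ M = p ^ m) : ∀ κ : ZpExtension M p, κ.IsCyclotomic → ClassicalMuVanishes κ :=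
  classicalMu_of_isGalois_of_finrank_eq_odd_prime_pow hodd m M₀ M hdeg (fun κ₀ hκ₀ ↦ hFW M₀ p κ₀ hκ₀)

/-- ★★ **Totally real `2`-power towers over an abelian base, `p = 2`**: `M₀/ℚ` abelian, `M/M₀` Galois of degree `2^m` with `M` totally real:
GRANTED Ferrero–Washington, `μ₂ = 0` for every cyclotomic `ℤ₂`-extension of `M` (Iwasawa 1973 Thm. 2 iterated, fact-free in the tree).  (The remaining
case — `p = 2`, `M` not totally real, `M₀` totally real — goes through §2 on a Galois closure, or §5's first theorem over `M₀(i)`.)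
[cite: FerreroWashington1979, main theorem] [cite: Iwasawa1973MuInvariants, Thm. 2] -/
theorem classicalMu_of_isGalois_two_pow_over_abelian_of_isTotallyReal_of_ferreroWashington
    (hFW : ferreroWashington1979_classicalMuVanishes) (m : ℕ) (M₀ M : Type) [Field M₀] [NumberField M₀] [IsAbelianGalois ℚ M₀] [Field M]
    [NumberField M] [Algebra M₀ M] [IsGalois M₀ M] [IsTotallyReal M] (hdeg : Module.finrank M₀ M = 2 ^ m) :
    ∀ κ : ZpExtension M 2, κ.IsCyclotomic → ClassicalMuVanishes κ :=
  haveI : Fact (Nat.Prime 2) := ⟨Nat.prime_two⟩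
  classicalMu_of_isGalois_of_finrank_eq_two_pow_of_isTotallyReal' m M₀ M hdeg (fun κ₀ hκ₀ ↦ hFW M₀ 2 κ₀ hκ₀)

/-- ★★ **Subfields, intrinsic form**: every number field `K` embedding in a Galois `p`-power extension `M` of a totally complex abelian number field
`M₀` has `μ_p = 0` for all its cyclotomic `ℤ_p`-extensions, GRANTED Ferrero–Washington (first theorem of §5 and the fact-free finite descent).
[cite: FerreroWashington1979, main theorem] [cite: Iwasawa1973MuInvariants, Thm. 3 and §3 (remark after Thm. 2)] -/
theorem classicalMuVanishes_of_algebra_isGalois_prime_pow_over_abelian_of_isTotallyComplex_of_ferreroWashington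
    (hFW : ferreroWashington1979_classicalMuVanishes) (p : ℕ) [Fact p.Prime] (m : ℕ) (M₀ M K : Type) [Field M₀] [NumberField M₀]
    [IsAbelianGalois ℚ M₀] [IsTotallyComplex M₀] [Field M] [NumberField M] [Algebra M₀ M] [IsGalois M₀ M]
    (hdeg : Module.finrank M₀ M = p ^ m) [Field K] [NumberField K] [Algebra K M] (κ : ZpExtension K p) (hκ : κ.IsCyclotomic) :
    ClassicalMuVanishes κ :=
  classicalMuVanishes_of_isCyclotomic_of_finite_noGrowth κ hκ M
    (classicalMu_of_isGalois_prime_pow_over_abelian_of_isTotallyComplex_of_ferreroWashington hFW p m M₀ M hdeg)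

end Literature.NumberTheory.IwasawaTheory

end
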